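import Summits.KontsevichZagierPeriods.KontsevichZagierPeriods.Theorems.RealOnePeriodRelations.Negative.Kit
import Summits.KontsevichZagierPeriods.KontsevichZagierPeriods.Theorems.HermiteRigidityGenusTwoCycleTransferPushforwardDimOne
import Literature.NumberTheory.Transcendental.KZSemialgebraicComplex
import Literature.NumberTheory.Transcendental.SemialgebraicLineDeriv
import Literature.NumberTheory.Transcendental.SemialgebraicMapsProofs
import Mathlib.MeasureTheory.Function.Jacobian

/-!
# `RealOnePeriodRelations` (stmt-KontsevichZagierPeriods-10042), line `nash-retraction-thin-strip` —
# stub `stub_normalisation`: cells, part 1 (null cells, 1a splitting, affine rescaling of a bounded cell)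

Three moves of the cell decomposition of a one-dimensional Kontsevich–Zagier representation `[∫_σ f]`
(design note `Cruxes/RealOnePeriodRelations/Lines/nash-retraction-thin-strip.normalisation-r0.md`, step N2),
each a single instance of rule 1a or rule 2 inside `M₁`:

* `of_mem_M₁_of_volume_zero` — a representation over a NULL domain (a point cell) lies in `M₁`
  (`[r] − [r] − [r] ∈ domainAddRel`);
* `split_mem_M₁` — rule 1a at a `ℚ`-semialgebraic set `A`: `[r] ≡ [r|_{σ ∩ A}] + [r|_{σ ∖ A}]`;
* `helper_normalisation_r0_2` (registered helper anchor) — rule 2 along the affine map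
  `s ↦ p + (q − p)s` with ALGEBRAIC `p < q`: a representation over the bounded cell `(p, q)` is equivalent to
  one over `(0, 1)` with integrand `(q − p) · f(p + (q − p)s)` (integrability transported by Mathlib's Jacobian
  formula `integrableOn_image_iff_integrableOn_abs_det_fderiv_smul`; algebraic constants are `ℚ`-semialgebraic,
  `isSemialgebraicFunOn_const_of_isAlgebraic`).

References: M. Kontsevich, D. Zagier, *Periods* (2001), §1.2 rules (1), (2).
-/

noncomputable section

open scoped BigOperators
open Set MeasureTheory
open Literature.NumberTheory.Transcendental
open Literature.ModelTheory.ExponentialFields (IsSemialgebraic)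
open Summit.KontsevichZagierPeriods.SymplecticScissors.RealOnePeriodRelationsNegative
  (M₁ unitDom isSemialgebraic_unitDom measurableSet_unitDom)

namespace Summit.KontsevichZagierPeriods.SymplecticScissors.RealOnePeriodRelations

namespace NormalisationCells

/-- **Null cells die.** A representation whose domain is Lebesgue-null lies in `M₁`: with
`r = r₁ = r₂`, `[r] − [r] − [r]` is an instance of rule 1a (`σ = σ ∪ σ`, `σ ∩ σ` null).
[cite: KontsevichZagier2001, §1.2 rule (1)] -/
theorem of_mem_M₁_of_volume_zero {n : ℕ} (r : KZ.IntegralRep n) (h : volume r.domain = 0) :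
    KZ.of r ∈ M₁ := by
  have h3 : KZ.of r - KZ.of r - KZ.of r ∈ M₁ := by
    refine AddSubgroup.subset_closure (Or.inl (Or.inl (Or.inl ?_)))
    exact ⟨n, r, r, r, (union_self _).symm, by rwa [inter_self], fun _ _ => rfl, fun _ _ => rfl, rfl⟩
  have e : KZ.of r = -(KZ.of r - KZ.of r - KZ.of r) := by abel
  rw [e]
  exact M₁.neg_mem h3

/-- A representation over a point cell `{z | z 0 = c}` of `ℝ¹` lies in `M₁`. [folklore] -/
theorem of_mem_M₁_of_domain_subset_singleton (r : KZ.IntegralRep 1) (c : ℝ)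
    (h : r.domain ⊆ {z : Fin 1 → ℝ | z 0 = c}) : KZ.of r ∈ M₁ := by
  refine of_mem_M₁_of_volume_zero r (measure_mono_null h ?_)
  have hs : {z : Fin 1 → ℝ | z 0 = c} = (MeasurableEquiv.funUnique (Fin 1) ℝ) ⁻¹' {c} := by
    ext z
    simp [MeasurableEquiv.funUnique_apply]
  have hmp : MeasurePreserving (MeasurableEquiv.funUnique (Fin 1) ℝ) volume volume :=
    volume_preserving_funUnique (Fin 1) ℝ
  rw [hs, hmp.measure_preimage (measurableSet_singleton c).nullMeasurableSet]
  exact Real.volume_singleton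

/-- **Rule 1a at a semialgebraic set.** For a `ℚ`-semialgebraic `A`, `[r] − [r|_{σ ∩ A}] − [r|_{σ ∖ A}] ∈ M₁`.
[cite: KontsevichZagier2001, §1.2 rule (1)] -/
theorem split_mem_M₁ {n : ℕ} (r : KZ.IntegralRep n) (A : Set (Fin n → ℝ)) (hA : IsSemialgebraic ℚ A) :
    KZ.of r - KZ.of (r.restrict (r.domain ∩ A) (r.isSemialgebraic_domain.inter hA) inter_subset_left) -
      KZ.of (r.restrict (r.domain \ A) (r.isSemialgebraic_domain.diff hA) sdiff_subset) ∈ M₁ := by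
  refine AddSubgroup.subset_closure (Or.inl (Or.inl (Or.inl ?_)))
  refine ⟨n, r, r.restrict (r.domain ∩ A) (r.isSemialgebraic_domain.inter hA) inter_subset_left,
    r.restrict (r.domain \ A) (r.isSemialgebraic_domain.diff hA) sdiff_subset, ?_, ?_,
    fun _ _ => rfl, fun _ _ => rfl, rfl⟩
  · simp
  · have h0 : r.domain ∩ A ∩ (r.domain \ A) = ∅ := by
      ext x
      simp only [mem_inter_iff, Set.mem_sdiff, mem_empty_iff_false, iff_false, not_and, not_not, and_imp]
      exact fun _ hA _ => hA
    simp [KZ.IntegralRep.domain_restrict, h0]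

/-- The affine map `s ↦ p + (q − p)s` of `ℝ¹`, as a self-map of `Fin 1 → ℝ`. [folklore] -/
theorem affine_isSemialgebraicMapOn {p q : ℝ} (hp : IsAlgebraic ℚ p) (hq : IsAlgebraic ℚ q)
    {s : Set (Fin 1 → ℝ)} (hs : IsSemialgebraic ℚ s) :
    IsSemialgebraicMapOn ℚ s (fun z : Fin 1 → ℝ => fun _ : Fin 1 => p + (q - p) * z 0) := by
  refine IsSemialgebraicMapOn.of_forall hs fun _ => ?_
  have hc1 : IsSemialgebraicFunOn ℚ s (fun _ => p) := isSemialgebraicFunOn_const_of_isAlgebraic hs hp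
  have hc2 : IsSemialgebraicFunOn ℚ s (fun _ => q - p) :=
    isSemialgebraicFunOn_const_of_isAlgebraic hs (hq.sub hp)
  have hx : IsSemialgebraicFunOn ℚ s (fun z : Fin 1 → ℝ => z 0) := by
    simpa using isSemialgebraicFunOn_aeval hs (MvPolynomial.X (0 : Fin 1) : MvPolynomial (Fin 1) ℚ)
  exact hc1.fun_add (hc2.fun_mul hx)

/-- The affine image of the unit interval: `(p + (q − p)·) '' (0,1) = (p, q)` in `ℝ¹`, for `p < q`.
[folklore] -/
theorem affine_image_unitDom {p q : ℝ} (hpq : p < q) :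
    (fun z : Fin 1 → ℝ => fun _ : Fin 1 => p + (q - p) * z 0) '' {z : Fin 1 → ℝ | z 0 ∈ Set.Ioo (0 : ℝ) 1} =
      {z : Fin 1 → ℝ | p < z 0 ∧ z 0 < q} := by
  have hqp : 0 < q - p := sub_pos.2 hpq
  ext w
  simp only [mem_image, mem_setOf_eq, mem_Ioo]
  constructor
  · rintro ⟨z, ⟨hz0, hz1⟩, rfl⟩
    constructor <;> nlinarith
  · rintro ⟨hw1, hw2⟩
    refine ⟨fun _ => (w 0 - p) / (q - p), ⟨div_pos (sub_pos.2 hw1) hqp, ?_⟩, ?_⟩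
    · rw [div_lt_one hqp]
      linarith
    · funext i
      rw [Subsingleton.elim i 0]
      field_simp
      ring

end NormalisationCells

open NormalisationCells in
/-- **Affine rescaling of a bounded cell** (registered helper anchor `helper_normalisation_r0_2` of
`stub_normalisation`). A one-dimensional representation over the cell `(p, q)` with algebraic end points
`p < q` is equivalent, by ONE instance of rule 2 along `s ↦ p + (q − p)s` (derivative `(q − p)·id`,
`|det| = q − p`), to a representation over `(0, 1)` with integrand `(q − p) · f(p + (q − p)s)`; the new
integrand is `ℚ`-semialgebraic (algebraic constants) and integrable (Jacobian formula).
[cite: KontsevichZagier2001, §1.2 rule (2)] -/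
theorem helper_normalisation_r0_2 : ∀ (r : KZ.IntegralRep 1) (p q : ℝ), p < q → IsAlgebraic ℚ p → IsAlgebraic ℚ q →
    r.domain = {z : Fin 1 → ℝ | p < z 0 ∧ z 0 < q} →
    ∃ r' : KZ.IntegralRep 1, r'.domain = {z | z 0 ∈ Set.Ioo (0 : ℝ) 1} ∧
      (∀ z ∈ r'.domain, r'.integrand z = (q - p) * r.integrand (fun _ : Fin 1 => p + (q - p) * z 0)) ∧
      KZ.of r' - KZ.of r ∈ KZ.changeOfVariablesRel := by
  intro r p q hpq hp hq hdom
  have hqp : 0 < q - p := sub_pos.2 hpq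
  -- the affine map and its derivative
  obtain ⟨Φ, hΦ⟩ : ∃ Φ : (Fin 1 → ℝ) → (Fin 1 → ℝ), Φ = fun z => fun _ => p + (q - p) * z 0 := ⟨_, rfl⟩
  obtain ⟨Φ', hΦ'⟩ : ∃ Φ' : (Fin 1 → ℝ) → (Fin 1 → ℝ) →L[ℝ] (Fin 1 → ℝ),
      Φ' = fun _ => (q - p) • ContinuousLinearMap.id ℝ (Fin 1 → ℝ) := ⟨_, rfl⟩
  have hΦapply : ∀ z : Fin 1 → ℝ, Φ z = fun _ => p + (q - p) * z 0 := fun z => by rw [hΦ]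
  have hderiv : ∀ z : Fin 1 → ℝ, HasFDerivAt Φ (Φ' z) z := fun z => by
    rw [hΦ, hΦ']
    have h : HasDerivAt (fun t : ℝ => p + (q - p) * t) (q - p) (z 0) := by
      simpa using ((hasDerivAt_id (z 0)).const_mul (q - p)).const_add p
    exact Summit.KontsevichZagierPeriods.HermiteRigidity.GenusTwoCycleTransfer.hasFDerivAt_fin_one
      (fun t => p + (q - p) * t) (q - p) z h
  have hdet : ∀ z : Fin 1 → ℝ, |(Φ' z).det| = q - p := fun z => by
    rw [hΦ']
    show |((q - p) • ContinuousLinearMap.id ℝ (Fin 1 → ℝ)).det| = q - p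
    rw [Summit.KontsevichZagierPeriods.HermiteRigidity.GenusTwoCycleTransfer.det_smul_id_fin_one, abs_of_pos hqp]
  have hinj : InjOn Φ {z : Fin 1 → ℝ | z 0 ∈ Set.Ioo (0 : ℝ) 1} := by
    intro z _ w _ hzw
    rw [hΦapply, hΦapply] at hzw
    have h0 : p + (q - p) * z 0 = p + (q - p) * w 0 := congr_fun hzw 0
    have h1 : z 0 = w 0 := by
      have := mul_left_cancel₀ hqp.ne' (add_left_cancel h0)
      exact this
    funext i
    rw [Subsingleton.elim i 0, h1]
  have himg : Φ '' {z : Fin 1 → ℝ | z 0 ∈ Set.Ioo (0 : ℝ) 1} = r.domain := by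
    rw [hdom, hΦ]
    exact affine_image_unitDom hpq
  have hmaps : MapsTo Φ {z : Fin 1 → ℝ | z 0 ∈ Set.Ioo (0 : ℝ) 1} r.domain := by
    rw [← himg]
    exact mapsTo_image Φ _
  have hsaΦ : IsSemialgebraicMapOn ℚ {z : Fin 1 → ℝ | z 0 ∈ Set.Ioo (0 : ℝ) 1} Φ := by
    rw [hΦ]
    exact affine_isSemialgebraicMapOn hp hq isSemialgebraic_unitDom
  -- the rescaled representation
  have hsa : IsSemialgebraicFunOn ℚ {z : Fin 1 → ℝ | z 0 ∈ Set.Ioo (0 : ℝ) 1}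
      (fun z => (q - p) * r.integrand (Φ z)) := by
    have hc : IsSemialgebraicFunOn ℚ {z : Fin 1 → ℝ | z 0 ∈ Set.Ioo (0 : ℝ) 1} (fun _ => q - p) :=
      isSemialgebraicFunOn_const_of_isAlgebraic isSemialgebraic_unitDom (hq.sub hp)
    exact hc.fun_mul (IsSemialgebraicFunOn.comp_isSemialgebraicMapOn_holds
      r.isSemialgebraicFunOn_integrand hsaΦ hmaps)
  have hint : IntegrableOn (fun z => (q - p) * r.integrand (Φ z)) {z : Fin 1 → ℝ | z 0 ∈ Set.Ioo (0 : ℝ) 1} := by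
    have h := (integrableOn_image_iff_integrableOn_abs_det_fderiv_smul (μ := volume) measurableSet_unitDom
      (fun z _ => (hderiv z).hasFDerivWithinAt) hinj r.integrand).1
      (by rw [show (unitDom : Set (Fin 1 → ℝ)) = {z : Fin 1 → ℝ | z 0 ∈ Set.Ioo (0 : ℝ) 1} from rfl, himg]
          exact r.integrableOn)
    refine h.congr_fun (fun z _ => ?_) measurableSet_unitDom
    simp only [hdet, smul_eq_mul]
  let r' : KZ.IntegralRep 1 :=
    ⟨{z : Fin 1 → ℝ | z 0 ∈ Set.Ioo (0 : ℝ) 1}, fun z => (q - p) * r.integrand (Φ z), isSemialgebraic_unitDom,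
      hsa, hint⟩
  refine ⟨r', rfl, fun z _ => ?_, ?_⟩
  · show (q - p) * r.integrand (Φ z) = (q - p) * r.integrand (fun _ : Fin 1 => p + (q - p) * z 0)
    rw [hΦapply]
  refine ⟨1, r', r, Φ, Φ', hsaΦ, fun z _ => (hderiv z).hasFDerivWithinAt, hinj, himg.symm, fun z _ => ?_, rfl⟩
  show (q - p) * r.integrand (Φ z) = r.integrand (Φ z) * |(Φ' z).det|
  rw [hdet, mul_comm]

end Summit.KontsevichZagierPeriods.SymplecticScissors.RealOnePeriodRelations

end
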